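import Mathlib
import HarnessLib
import Literature.MathematicalPhysics.QuantumFieldTheory.U1GinibreComparison
import Summits.Ventures.LatticeQCDFlow.Scaling.Wilson2DU1PlaquetteDensity

/-!
# LatticeQCDFlow / Scaling — `U(1)` lattice gauge theory in ANY dimension: the plaquette has a
# strictly positive mean, `⟨Re U_p⟩_β > 0` for every `β > 0` (Ginibre's inequality)

HONEST FRAMING: exact (Metropolis-corrected) sampling algorithms for lattice gauge theory;
figures of merit are autocorrelation/cost numbers at stated couplings and volumes; no
continuum-physics claim.

Venture `LatticeQCDFlow` (cell pub-lqcd), topic `Scaling`, FANOUT row 30 (lean-1, GEN-18) — OUR WORK, the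
input that lifts the `U(1)` lower bounds on the exact autoregressive context (THEORY-2 §4 row C5,
gauge case: `Scaling/AutoregressiveGaugePlaquetteReads`, `…DominoReads`, two-dimensional so far, where
the plaquette law is an explicit convolution power) to EVERY dimension `d` — in particular `d = 4`.
Wilson action, gauge group `U(1)`, torus `(ℤ/L)^d`, `L ≥ 2`, product Haar reference measure.

* §1 `integral_exp_mul_re_pos`, **`integral_re_mul_exp_mul_re_pos`** — on `U(1)`:
  `∫ e^{β Re u} du > 0` and, for `β > 0`, `∫ Re u · e^{β Re u} du > 0` (reflection `u ↦ −u`: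
  the symmetrised integrand is `Re u · sinh(β Re u) ≥ 0`, positive near `u = 1`).
* §2 `exp_neg_mul_wilsonAction_u1_eq_ginibreWeight` — `e^{−β S_W} = e^{−β|P|}·exp(Σ_q β Re U_q)`:
  the `U(1)` Wilson weight on `(ℤ/L)^d` is a Ginibre weight for the family of plaquette characters
  (the tree's `U1GinibreComparison.exp_neg_mul_wilsonAction_u1` is the case `d = 4`);
  `ginibreExpect_singlePlaquette` — switching off every coupling but the one of `p` leaves the
  one-plaquette tilted Haar law: `⟨Re U_p⟩_{β·1_p} = ∫ Re u e^{β Re u} / ∫ e^{β Re u}` (the plaquette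
  holonomy is Haar distributed under product Haar, `integral_comp_plaquetteHolonomy`).
* §3 **`wilson_u1_integral_re_plaquette_pos`** / **`wilson_u1_plaquette_mean_pos`** — for every
  `d`, `L ≥ 2`, `β > 0` and every plaquette `p`: `∫ Re(U_p) e^{−β S_W(U)} dHaar^{⊗E}(U) > 0`, i.e.
  `⟨Re U_p⟩_{β} > 0`.  Proof: GINIBRE'S INEQUALITY (tree
  `Literature.Probability.LatticeModels.ginibreExpect_reChar_mono`, J. Ginibre, Comm. Math. Phys. 16
  (1970) 310; every `U(1)` configuration is a square, `exists_mul_self_eq_u1Config`): `⟨Re U_p⟩` is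
  non-decreasing in every plaquette coupling, so `⟨Re U_p⟩_β ≥ ⟨Re U_p⟩_{β·1_p} > 0`.

READING (value-free): the law of a plaquette holonomy of `U(1)` lattice gauge theory is NOT Haar at
any `β > 0`, in any dimension and volume — the non-perturbative input for "the closing link reads its
staple" beyond `d = 2` (sequel `Scaling/AutoregressiveGaugePlaquetteReadsAnyDim`).  NOT CLAIMED:
non-abelian groups (no Ginibre inequality); any rate in `β`; any number of ours.  Elementary over the
parents; no `def`; the one cited input (Ginibre 1970) is the tree's proved Literature theorem; no
`sorry`.
-/

noncomputable section

namespace Summit.Ventures.LatticeQCDFlow.Theory2.Autoregressive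

open MeasureTheory Function Set
open Literature.MathematicalPhysics.QuantumFieldTheory Literature.MathematicalPhysics.QuantumLattice
open Literature.Probability.LatticeModels
open Summit.Ventures.LatticeQCDFlow.Theory2.Lattice.TwoDim (measurable_circle_re abs_circle_re_le_one)

/-! ## §1 One-plaquette integrals on `U(1)` -/

/-- `∫ e^{β Re u} dHaar(u) > 0`. [ours] -/
theorem integral_exp_mul_re_pos (β : ℝ) :
    0 < ∫ u : Circle, Real.exp (β * ((u : Circle) : ℂ).re) ∂(haarProbability Circle) := by
  refine integral_exp_pos (Integrable.mono' (integrable_const (Real.exp |β|)) ?_ (ae_of_all _ fun u => ?_))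
  · have hc : Continuous fun u : Circle => Real.exp (β * ((u : Circle) : ℂ).re) := by fun_prop
    exact hc.aestronglyMeasurable
  · rw [Real.norm_eq_abs, abs_of_pos (Real.exp_pos _)]
    refine Real.exp_le_exp.2 ?_
    have h := abs_circle_re_le_one u
    calc β * ((u : Circle) : ℂ).re ≤ |β * ((u : Circle) : ℂ).re| := le_abs_self _
      _ = |β| * |((u : Circle) : ℂ).re| := abs_mul _ _
      _ ≤ |β| * 1 := mul_le_mul_of_nonneg_left h (abs_nonneg _)
      _ = |β| := mul_one _

/-- **`∫ Re u · e^{β Re u} dHaar(u) > 0` for `β > 0`**: reflecting `u ↦ −u` (left invariance of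
Haar), twice the integral is `∫ Re u (e^{β Re u} − e^{−β Re u}) = ∫ 2 Re u · sinh(β Re u)`, a
continuous non-negative integrand, positive at `u = 1`; Haar measure charges open sets. [ours] -/
theorem integral_re_mul_exp_mul_re_pos {β : ℝ} (hβ : 0 < β) :
    0 < ∫ u : Circle, ((u : Circle) : ℂ).re * Real.exp (β * ((u : Circle) : ℂ).re) ∂(haarProbability Circle) := by
  set μ := haarProbability Circle with hμ
  set r : Circle → ℝ := fun u => ((u : Circle) : ℂ).re with hr
  have hrc : Continuous r := Complex.continuous_re.comp continuous_subtype_val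
  set F : Circle → ℝ := fun u => r u * Real.exp (β * r u) with hF
  have hFc : Continuous F := by simp only [hF]; fun_prop
  have hFb : ∀ u, |F u| ≤ 1 * Real.exp |β| := by
    intro u
    rw [hF]
    simp only [abs_mul, abs_of_pos (Real.exp_pos _)]
    refine mul_le_mul (abs_circle_re_le_one u) (Real.exp_le_exp.2 ?_) (Real.exp_pos _).le zero_le_one
    have h := abs_circle_re_le_one u
    calc β * r u ≤ |β * r u| := le_abs_self _
      _ = |β| * |r u| := abs_mul _ _
      _ ≤ |β| * 1 := mul_le_mul_of_nonneg_left h (abs_nonneg _)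
      _ = |β| := mul_one _
  have hFi : Integrable F μ := Integrable.mono' (integrable_const _) hFc.measurable.aestronglyMeasurable
    (ae_of_all _ fun u => by rw [Real.norm_eq_abs]; exact hFb u)
  -- reflection
  have hrefl : ∫ u, F (-1 * u) ∂μ = ∫ u, F u ∂μ := integral_mul_left_eq_self F (-1 : Circle)
  have hFneg : ∀ u, F (-1 * u) = -r u * Real.exp (-(β * r u)) := by
    intro u
    simp only [hF, hr, neg_one_mul, Circle.coe_neg, Complex.neg_re, mul_neg]
  -- the symmetrised integrand
  set H : Circle → ℝ := fun u => r u * Real.sinh (β * r u) with hH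
  have hHc : Continuous H := by simp only [hH]; fun_prop
  have hsum : ∀ u, F u + F (-1 * u) = 2 * H u := by
    intro u
    rw [hFneg]
    simp only [hF, hH, Real.sinh_eq]
    ring
  have hH0 : ∀ u, 0 ≤ H u := by
    intro u
    simp only [hH]
    rcases le_or_gt 0 (r u) with h | h
    · exact mul_nonneg h (Real.sinh_nonneg_iff.2 (mul_nonneg hβ.le h))
    · have : Real.sinh (β * r u) < 0 := Real.sinh_neg_iff.2 (mul_neg_of_pos_of_neg hβ h)
      nlinarith
  have hHi : Integrable H μ := by
    have h2 : Integrable (fun u => F u + F (-1 * u)) μ := hFi.add (hFi.comp_mul_left (-1 : Circle))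
    refine (h2.div_const 2).congr (ae_of_all _ fun u => ?_)
    simp only [hsum]; ring
  have hint : ∫ u, F u ∂μ = ∫ u, H u ∂μ := by
    have h2 : ∫ u, (F u + F (-1 * u)) ∂μ = 2 * ∫ u, F u ∂μ := by
      rw [integral_add hFi (hFi.comp_mul_left (-1 : Circle)), hrefl]; ring
    have h3 : ∫ u, (F u + F (-1 * u)) ∂μ = 2 * ∫ u, H u ∂μ := by
      simp_rw [hsum]; rw [integral_const_mul]
    linarith
  rw [hint, integral_pos_iff_support_of_nonneg hH0 hHi]
  have hopen : IsOpen (support H) := hHc.isOpen_support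
  have h1 : (1 : Circle) ∈ support H := by
    rw [mem_support]
    simp only [hH, hr, Circle.coe_one, Complex.one_re, mul_one, one_mul]
    exact (Real.sinh_pos_iff.2 hβ).ne'
  exact hopen.measure_pos μ ⟨1, h1⟩

/-! ## §2 The `U(1)` Wilson weight as a Ginibre weight; the single-plaquette expectation -/

variable {d L : ℕ} [NeZero L]

/-- **`e^{−β S_W(U)} = e^{−β|P|}·exp(Σ_q β Re U_q)`**: on `(ℤ/L)^d` the `U(1)` Wilson weight is the
Ginibre weight of the family of plaquette characters with constant couplings `β`, up to a constant
(general-`d` form of the tree's `exp_neg_mul_wilsonAction_u1`). [ours] -/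
theorem exp_neg_mul_wilsonAction_u1_eq_ginibreWeight (β : ℝ) (U : GaugeConfig d L Circle) :
    Real.exp (-β * wilsonAction u1Rep U) =
      Real.exp (-β * Fintype.card (Plaquette d L)) *
        ginibreWeight (fun q : Plaquette d L => u1PlaqChar q.1 q.2.1.1 q.2.1.2) (fun _ => β) U := by
  rw [ginibreWeight, ← Real.exp_add]
  congr 1
  have h1 : wilsonAction u1Rep U = Fintype.card (Plaquette d L) -
      ∑ q : Plaquette d L, ((plaquetteHolonomy U q.1 q.2.1.1 q.2.1.2 : Circle) : ℂ).re := by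
    simp only [wilsonAction, trace_u1Rep_re, Nat.cast_one, Finset.sum_sub_distrib, Finset.sum_const,
      Finset.card_univ, nsmul_eq_mul, mul_one]
  have h2 : ginibreHamiltonian (fun q : Plaquette d L => u1PlaqChar q.1 q.2.1.1 q.2.1.2) (fun _ => β) U =
      β * ∑ q : Plaquette d L, ((plaquetteHolonomy U q.1 q.2.1.1 q.2.1.2 : Circle) : ℂ).re := by
    simp only [ginibreHamiltonian, reChar, u1PlaqChar_apply, ← Finset.mul_sum]
  rw [h1, h2]
  ring

/-- **The single-plaquette Ginibre expectation**: with every coupling switched off except the one of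
`p`, `⟨Re U_p⟩ = ∫ Re u e^{β Re u} du / ∫ e^{β Re u} du` (the plaquette holonomy is Haar distributed
under product Haar; `L ≥ 2`). [ours] -/
theorem ginibreExpect_singlePlaquette [DecidableEq (Plaquette d L)] (hL : 2 ≤ L) (β : ℝ)
    (p : Plaquette d L) :
    ginibreExpect (Measure.pi fun _ : Edge d L => haarProbability Circle)
        (fun q : Plaquette d L => u1PlaqChar q.1 q.2.1.1 q.2.1.2) (fun q => if q = p then β else 0)
        (reChar (u1PlaqChar p.1 p.2.1.1 p.2.1.2)) =
      (∫ u : Circle, ((u : Circle) : ℂ).re * Real.exp (β * ((u : Circle) : ℂ).re) ∂(haarProbability Circle)) /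
        ∫ u : Circle, Real.exp (β * ((u : Circle) : ℂ).re) ∂(haarProbability Circle) := by
  have hij : p.2.1.1 ≠ p.2.1.2 := ne_of_lt p.2.2
  have hHam : ∀ U : GaugeConfig d L Circle,
      ginibreHamiltonian (fun q : Plaquette d L => u1PlaqChar q.1 q.2.1.1 q.2.1.2)
          (fun q => if q = p then β else 0) U =
        β * ((plaquetteHolonomy U p.1 p.2.1.1 p.2.1.2 : Circle) : ℂ).re := by
    intro U
    simp only [ginibreHamiltonian, reChar, u1PlaqChar_apply, ite_mul, zero_mul, Finset.sum_ite_eq',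
      Finset.mem_univ, if_true]
  unfold ginibreExpect ginibreWeight
  simp only [hHam, reChar, u1PlaqChar_apply]
  have hb1 : ∀ u : Circle, |((u : Circle) : ℂ).re * Real.exp (β * ((u : Circle) : ℂ).re)| ≤ 1 * Real.exp |β| := by
    intro u
    rw [abs_mul, abs_of_pos (Real.exp_pos _)]
    refine mul_le_mul (abs_circle_re_le_one u) (Real.exp_le_exp.2 ?_) (Real.exp_pos _).le zero_le_one
    calc β * ((u : Circle) : ℂ).re ≤ |β * ((u : Circle) : ℂ).re| := le_abs_self _
      _ = |β| * |((u : Circle) : ℂ).re| := abs_mul _ _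
      _ ≤ |β| * 1 := mul_le_mul_of_nonneg_left (abs_circle_re_le_one u) (abs_nonneg _)
      _ = |β| := mul_one _
  have hb2 : ∀ u : Circle, |Real.exp (β * ((u : Circle) : ℂ).re)| ≤ Real.exp |β| := by
    intro u
    rw [abs_of_pos (Real.exp_pos _)]
    refine Real.exp_le_exp.2 ?_
    calc β * ((u : Circle) : ℂ).re ≤ |β * ((u : Circle) : ℂ).re| := le_abs_self _
      _ = |β| * |((u : Circle) : ℂ).re| := abs_mul _ _
      _ ≤ |β| * 1 := mul_le_mul_of_nonneg_left (abs_circle_re_le_one u) (abs_nonneg _)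
      _ = |β| := mul_one _
  have hm1 : Measurable fun u : Circle => ((u : Circle) : ℂ).re * Real.exp (β * ((u : Circle) : ℂ).re) :=
    measurable_circle_re.mul (Real.measurable_exp.comp (measurable_circle_re.const_mul β))
  have hm2 : Measurable fun u : Circle => Real.exp (β * ((u : Circle) : ℂ).re) :=
    Real.measurable_exp.comp (measurable_circle_re.const_mul β)
  rw [integral_comp_plaquetteHolonomy hL p.1 hij
      (H := fun u : Circle => ((u : Circle) : ℂ).re * Real.exp (β * ((u : Circle) : ℂ).re)) hm1 hb1,
    integral_comp_plaquetteHolonomy hL p.1 hij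
      (H := fun u : Circle => Real.exp (β * ((u : Circle) : ℂ).re)) hm2 hb2]

/-! ## §3 The plaquette mean is positive in every dimension -/

/-- **`∫ Re(U_p) e^{−β S_W(U)} dHaar^{⊗E}(U) > 0`** for `U(1)` on `(ℤ/L)^d`, every `d`, `L ≥ 2`,
`β > 0`, every plaquette `p` — by Ginibre's inequality (monotonicity of `⟨Re U_p⟩` in the plaquette
couplings, tree `ginibreExpect_reChar_mono`) down to the single-plaquette theory, where it is the
positive number of §1. [ours] -/
theorem wilson_u1_integral_re_plaquette_pos (hL : 2 ≤ L) {β : ℝ} (hβ : 0 < β) (p : Plaquette d L) :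
    0 < ∫ U : GaugeConfig d L Circle,
        ((plaquetteHolonomy U p.1 p.2.1.1 p.2.1.2 : Circle) : ℂ).re * Real.exp (-β * wilsonAction u1Rep U)
        ∂Measure.pi (fun _ : Edge d L => haarProbability Circle) := by
  classical
  set μ := Measure.pi (fun _ : Edge d L => haarProbability Circle) with hμ
  set χ : Plaquette d L → (GaugeConfig d L Circle →ₜ* Circle) :=
    fun q => u1PlaqChar q.1 q.2.1.1 q.2.1.2 with hχ
  set J₀ : Plaquette d L → ℝ := fun q => if q = p then β else 0 with hJ₀
  -- Ginibre: the single-plaquette expectation is below the full one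
  have hmono : ginibreExpect μ χ J₀ (reChar (χ p)) ≤ ginibreExpect μ χ (fun _ => β) (reChar (χ p)) :=
    ginibreExpect_reChar_mono μ (fun θ => exists_mul_self_eq_u1Config θ) χ (χ p)
      (fun q => by simp only [hJ₀]; split_ifs <;> [exact hβ.le; exact le_rfl])
      (fun q => by simp only [hJ₀]; split_ifs <;> [exact le_rfl; exact hβ.le])
  -- the single-plaquette expectation is positive
  have hsingle : 0 < ginibreExpect μ χ J₀ (reChar (χ p)) := by
    rw [hμ, hχ, hJ₀, ginibreExpect_singlePlaquette hL β p]
    exact div_pos (integral_re_mul_exp_mul_re_pos hβ) (integral_exp_mul_re_pos β)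
  have hfull : 0 < ginibreExpect μ χ (fun _ => β) (reChar (χ p)) := lt_of_lt_of_le hsingle hmono
  -- unfold the full expectation: a positive ratio with a positive denominator
  have hwc : Continuous (ginibreWeight χ fun _ => β) := continuous_ginibreWeight χ _
  have hZ : 0 < ∫ U, ginibreWeight χ (fun _ => β) U ∂μ :=
    integral_exp_pos (integrable_of_continuous_compactSpace μ hwc)
  have hnum : 0 < ∫ U, reChar (χ p) U * ginibreWeight χ (fun _ => β) U ∂μ := by
    have h := hfull
    unfold ginibreExpect at h
    exact (div_pos_iff.1 h).elim (fun h' => h'.1) fun h' => absurd h'.2 (not_lt.2 hZ.le)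
  -- back to the Wilson weight
  have hrw : ∀ U : GaugeConfig d L Circle,
      ((plaquetteHolonomy U p.1 p.2.1.1 p.2.1.2 : Circle) : ℂ).re * Real.exp (-β * wilsonAction u1Rep U) =
        Real.exp (-β * Fintype.card (Plaquette d L)) * (reChar (χ p) U * ginibreWeight χ (fun _ => β) U) := by
    intro U
    rw [exp_neg_mul_wilsonAction_u1_eq_ginibreWeight]
    simp only [hχ, reChar, u1PlaqChar_apply]
    ring
  simp_rw [hrw]
  rw [integral_const_mul]
  exact mul_pos (Real.exp_pos _) hnum

/-- **`⟨Re U_p⟩_β > 0`** — THE PLAQUETTE OF `U(1)` LATTICE GAUGE THEORY HAS A STRICTLY POSITIVE MEAN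
in every dimension `d`, every volume `L ≥ 2`, at every `β > 0`. [ours] -/
theorem wilson_u1_plaquette_mean_pos (hL : 2 ≤ L) {β : ℝ} (hβ : 0 < β) (p : Plaquette d L) :
    0 < wilsonExpectation (L := L) u1Rep β
      (fun U : GaugeConfig d L Circle => ((plaquetteHolonomy U p.1 p.2.1.1 p.2.1.2 : Circle) : ℂ).re) := by
  rw [wilsonExpectation_eq_div_integral u1Rep continuous_u1Rep]
  refine div_pos (wilson_u1_integral_re_plaquette_pos hL hβ p) ?_
  have hwc : Continuous fun U : GaugeConfig d L Circle => -β * wilsonAction u1Rep U :=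
    continuous_const.mul (continuous_wilsonAction u1Rep continuous_u1Rep)
  exact integral_exp_pos (integrable_of_continuous_compactSpace _ (Real.continuous_exp.comp hwc))

end Summit.Ventures.LatticeQCDFlow.Theory2.Autoregressive

end
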